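import Summits.ValiantsHypothesis.ValiantsHypothesis.Theorems.KPlusLogSqLawTropicalBStaticFiveTriangleTables

/-!
# `TropicalB` (stmt-ValiantsHypothesis-19771) — the static `5 × 5` cell, TRIANGLE LAW: the laws along a dominant chain (split squares, edge rule, parity classes) and counting in a coset

Cell `pub-symmetroid`, seat val-sym-trop-p4 (g8).  HONEST FRAMING: a finite STATIC (Birkhoff-shadow) census statement at size `5` in the currency
of `TropicalB`'s orbit (stmt-ValiantsHypothesis-19771); nothing here bears on `TropicalB` in its window, `WeakLifting`, `MatrixDescartes`
(stmt-ValiantsHypothesis-18050) or VP ≠ VNP.  Memo `HOME/val-sym-trop-p4/g8/TRIANGLE-LAW-g8.md`.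

THE TRIANGLE LAW (four files `…StaticFiveTriangleTables / …Laws / …Extract / …Triangle`): in a STATIC `5 × 5` design the three `S₂ × S₃`
cosets `σ({0,1}) = {0,1}, {0,2}, {1,2}` of dominant permutations (at most `7` each) are never simultaneously full, so at most `20` terms of a dominant
chain send the columns `0,1` into a given row triple, and by double counting over the `10` row triples a static `5 × 5` design has at most `66`
dominant terms along a chain (`static_row_five_sixtyfive`, record `69 + 1 = 70` of `StaticHalving.static_row_five`).  PROOF (memo §4): split-square law
(`ExchangeSquare.not_dominant_split_square`, p493290) inside a coset (`S = {0,1}`) and across cosets (`S` = a column pair of `{2,3,4}`), EDGE RULE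
(diagonal bracketing `Bracketing.slope_bracket_split`, p522470), slope LATIN identity + parity-class law (p522470) = LEMMA X
(`StaticFiveTriangle.coset_core_*`, p542783), sign chain `StaticFiveTriangle.triangle_core` through the common block exchanges of rows `3, 4`.
The `36` permutations of the family are `perm36 i l u` (coset `i : Fin 3` = rows `(0,1),(0,2),(1,2)` on columns `0,1`; left `l : Fin 2`, `l = 0` =
smaller row at column `0`; right `u : Fin 6` = the bijection columns `(2,3,4) → (y,3,4)` composed with the `u`-th element of `S₃` in the order
`id, (120), (201), (021), (210), (102)` — `0,1,2` even, `3,4,5` odd, pairs `{u, u+3}` = positions `34, 23, 24`).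

THIS FILE: for a dominant chain of a static design: occurring family permutations carry `lterm` (`dom_of_W`); the split-square law for four family permutations (`not_all_four`), inside a coset (`sq_int`) and across cosets (`sq_cross`); the EDGE RULE (`edge`); the parity-class law for the even / odd class of a coset (`law_even`, `law_odd`); counting: at most `7` occurring `(left, right)` pairs per coset and the structure of `7` (`coset_count`).
[this seat]
-/

set_option linter.dupNamespace false
set_option autoImplicit false

namespace Summit.ValiantsHypothesis.ValiantsHypothesis.Theorems.KPlusLogSqLaw.StaticFiveTriangle

open Summit.ValiantsHypothesis.ValiantsHypothesis.Theorems.MatrixDescartes.Negative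
open Summit.ValiantsHypothesis.ValiantsHypothesis.Theorems.LacunarySymmetroidMatrixDescartes
open Summit.ValiantsHypothesis.ValiantsHypothesis.Theorems.LacunarySymmetroidMatrixDescartes.TropicalCensus
open Finset

/-! ### 4. A dominant chain of a static design: the family's dominant terms, the split-square laws, the edge rule, the parity-class law -/

section Chain

variable {K : ℕ} (d : Fin K → ℕ) (v : Fin 5 → Fin 5 → Fin K → ℤ) {ε : Fin 5 → Fin 5 → Fin K → ℤ} {cls : Fin 5 → Fin 5 → Fin K}
variable {n : ℕ} {θ : Fin (n + 1) → ℤ} {p : Fin (n + 1) → Equiv.Perm (Fin 5) × (Fin 5 → Fin K)}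

/-- a permutation of the family occurring along the chain carries the dominant term `lterm cls i l u`. -/
theorem dom_of_W (hs : IsStatic ε) (hcls : ∀ r c k, ε r c k ≠ 0 → ε r c (cls r c) ≠ 0)
    (hdom : ∀ k, IsDominant d v ε (θ k) (p k)) {i : Fin 3} {l : Fin 2} {u : Fin 6} (h : (∃ k, (p k).1 = perm36 i l u)) :
    ∃ k, IsDominant d v ε (θ k) (lterm cls i l u) := by
  obtain ⟨k, hk⟩ := h
  exact ⟨k, by rw [← eq_lterm hs hcls (hdom k).1 hk]; exact hdom k⟩

/-- two different dominant terms are dominant at different parameters. -/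
theorem θ_ne_of_dom {q q' : Equiv.Perm (Fin 5) × (Fin 5 → Fin K)} {a b : Fin (n + 1)} (hqq : q ≠ q')
    (ha : IsDominant d v ε (θ a) q) (hb : IsDominant d v ε (θ b) q') : θ a ≠ θ b := by
  intro heq
  rw [heq] at ha
  exact lt_irrefl _ ((ha.2 _ (Ne.symm hqq) hb.1).trans (hb.2 _ hqq ha.1))

/-- **SPLIT-SQUARE LAW for four family permutations** glued from two `S`-parts and two `Sᶜ`-parts (cells read off `row36`): not all four occur. -/
theorem not_all_four (hs : IsStatic ε) (hcls : ∀ r c k, ε r c k ≠ 0 → ε r c (cls r c) ≠ 0) (hdom : ∀ k, IsDominant d v ε (θ k) (p k))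
    (S : Finset (Fin 5)) {a₁ a₂ a₃ a₄ : Fin 3 × Fin 2 × Fin 6}
    (hL : ∀ c ∈ S, row36 a₁.1 a₁.2.1 a₁.2.2 c = row36 a₂.1 a₂.2.1 a₂.2.2 c)
    (hL' : ∀ c ∈ S, row36 a₃.1 a₃.2.1 a₃.2.2 c = row36 a₄.1 a₄.2.1 a₄.2.2 c)
    (hR : ∀ c, c ∉ S → row36 a₁.1 a₁.2.1 a₁.2.2 c = row36 a₃.1 a₃.2.1 a₃.2.2 c)
    (hR' : ∀ c, c ∉ S → row36 a₂.1 a₂.2.1 a₂.2.2 c = row36 a₄.1 a₄.2.1 a₄.2.2 c)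
    (h12 : a₁ ≠ a₂) (h13 : a₁ ≠ a₃)
    (w₁ : (∃ k, (p k).1 = perm36 a₁.1 a₁.2.1 a₁.2.2)) (w₂ : (∃ k, (p k).1 = perm36 a₂.1 a₂.2.1 a₂.2.2)) (w₃ : (∃ k, (p k).1 = perm36 a₃.1 a₃.2.1 a₃.2.2)) (w₄ : (∃ k, (p k).1 = perm36 a₄.1 a₄.2.1 a₄.2.2)) : False := by
  obtain ⟨k₁, d₁⟩ := dom_of_W d v hs hcls hdom w₁
  obtain ⟨k₂, d₂⟩ := dom_of_W d v hs hcls hdom w₂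
  obtain ⟨k₃, d₃⟩ := dom_of_W d v hs hcls hdom w₃
  obtain ⟨k₄, d₄⟩ := dom_of_W d v hs hcls hdom w₄
  have cell : ∀ {b b' : Fin 3 × Fin 2 × Fin 6} {c : Fin 5}, row36 b.1 b.2.1 b.2.2 c = row36 b'.1 b'.2.1 b'.2.2 c →
      (lterm cls b.1 b.2.1 b.2.2).1 c = (lterm cls b'.1 b'.2.1 b'.2.2).1 c ∧
        (lterm cls b.1 b.2.1 b.2.2).2 c = (lterm cls b'.1 b'.2.1 b'.2.2).2 c := by
    intro b b' c h
    refine ⟨?_, ?_⟩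
    · show perm36 _ _ _ c = perm36 _ _ _ c
      rw [← row36_eq, ← row36_eq, h]
    · show cls (row36 _ _ _ c) c = cls (row36 _ _ _ c) c
      rw [h]
  refine ExchangeSquare.not_dominant_split_square d v ε S (fun c hc => cell (hL c hc)) (fun c hc => cell (hL' c hc))
    (fun c hc => cell (hR c hc)) (fun c hc => cell (hR' c hc)) ?_ ?_ d₁ d₂ d₃ d₄
  · exact lterm_ne cls fun h => h12 (Prod.ext h.1 (Prod.ext h.2.1 h.2.2))
  · exact lterm_ne cls fun h => h13 (Prod.ext h.1 (Prod.ext h.2.1 h.2.2))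

/-- **internal square**: two lefts × two rights of one coset never all occur. -/
theorem sq_int (hs : IsStatic ε) (hcls : ∀ r c k, ε r c k ≠ 0 → ε r c (cls r c) ≠ 0) (hdom : ∀ k, IsDominant d v ε (θ k) (p k))
    {i : Fin 3} {u u' : Fin 6} (huu : u ≠ u') (w₁ : (∃ k, (p k).1 = perm36 i 0 u)) (w₂ : (∃ k, (p k).1 = perm36 i 0 u')) (w₃ : (∃ k, (p k).1 = perm36 i 1 u)) (w₄ : (∃ k, (p k).1 = perm36 i 1 u')) : False := by
  refine not_all_four d v hs hcls hdom ({0, 1} : Finset (Fin 5)) (a₁ := (i, 0, u)) (a₂ := (i, 0, u')) (a₃ := (i, 1, u)) (a₄ := (i, 1, u'))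
    ?_ ?_ ?_ ?_ ?_ ?_ w₁ w₂ w₃ w₄
  · intro c hc
    have : c.val < 2 := by simp only [Finset.mem_insert, Finset.mem_singleton] at hc; rcases hc with rfl | rfl <;> decide
    exact (row36_split i 0 0 u u' c).1 this
  · intro c hc
    have : c.val < 2 := by simp only [Finset.mem_insert, Finset.mem_singleton] at hc; rcases hc with rfl | rfl <;> decide
    exact (row36_split i 1 1 u u' c).1 this
  · intro c hc
    have : 2 ≤ c.val := by
      simp only [Finset.mem_insert, Finset.mem_singleton, not_or] at hc
      have h5 := c.isLt; rcases c with ⟨c, _⟩; simp only [Fin.ext_iff] at hc; simp only at hc ⊢; omega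
    exact (row36_split i 0 1 u u c).2 this
  · intro c hc
    have : 2 ≤ c.val := by
      simp only [Finset.mem_insert, Finset.mem_singleton, not_or] at hc
      have h5 := c.isLt; rcases c with ⟨c, _⟩; simp only [Fin.ext_iff] at hc; simp only at hc ⊢; omega
    exact (row36_split i 0 1 u' u' c).2 this
  · simp [huu]
  · simp

/-- **cross square**: the two rights of a pair, once with `(i, l)` and once with `(j, l') ≠ (i, l)`, never all occur. -/
theorem sq_cross (hs : IsStatic ε) (hcls : ∀ r c k, ε r c k ≠ 0 → ε r c (cls r c) ≠ 0) (hdom : ∀ k, IsDominant d v ε (θ k) (p k))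
    {i j : Fin 3} {l l' : Fin 2} (hij : (i, l) ≠ (j, l')) (q : Fin 3)
    (w₁ : (∃ k, (p k).1 = perm36 i l (evn q))) (w₂ : (∃ k, (p k).1 = perm36 j l' (evn q))) (w₃ : (∃ k, (p k).1 = perm36 i l (prt q))) (w₄ : (∃ k, (p k).1 = perm36 j l' (prt q))) : False := by
  refine not_all_four d v hs hcls hdom ((univ : Finset (Fin 5)).filter fun c => c = posA q ∨ c = posB q)
    (a₁ := (i, l, evn q)) (a₂ := (j, l', evn q)) (a₃ := (i, l, prt q)) (a₄ := (j, l', prt q)) ?_ ?_ ?_ ?_ ?_ ?_ w₁ w₂ w₃ w₄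
  · intro c hc; simp only [Finset.mem_filter, Finset.mem_univ, true_and] at hc; exact ((row36_pair i j l l' q c).1 hc).1
  · intro c hc; simp only [Finset.mem_filter, Finset.mem_univ, true_and] at hc; exact ((row36_pair i j l l' q c).1 hc).2
  · intro c hc; simp only [Finset.mem_filter, Finset.mem_univ, true_and] at hc; exact (row36_pair i i l l q c).2 hc
  · intro c hc; simp only [Finset.mem_filter, Finset.mem_univ, true_and] at hc; exact (row36_pair j j l' l' q c).2 hc
  · intro h; apply hij; simp only [Prod.mk.injEq] at h ⊢; exact ⟨h.1, h.2.1⟩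
  · intro h; simp only [Prod.mk.injEq, evn, prt, Fin.mk.injEq] at h; omega

/-- **EDGE RULE**: if right `u` occurs with the left `0` and a different right `u'` with the left `1` (a dominant DIAGONAL of an internal square),
then the mixed corners lie strictly between in slope: the left orientation and the right move have the same sign. -/
theorem edge (hs : IsStatic ε) (hcls : ∀ r c k, ε r c k ≠ 0 → ε r c (cls r c) ≠ 0)
    (hθ : StrictMono θ) (hdom : ∀ k, IsDominant d v ε (θ k) (p k))
    {i : Fin 3} {u u' : Fin 6} (huu : u ≠ u') (w₁ : (∃ k, (p k).1 = perm36 i 0 u)) (w₄ : (∃ k, (p k).1 = perm36 i 1 u')) :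
    0 < (cellL (aOf d cls) i 1 - cellL (aOf d cls) i 0) * (cellR (aOf d cls) i u' - cellR (aOf d cls) i u) := by
  obtain ⟨k₁, d₁⟩ := dom_of_W d v hs hcls hdom w₁
  obtain ⟨k₄, d₄⟩ := dom_of_W d v hs hcls hdom w₄
  have _ := hθ
  have hne : lterm cls i 0 u ≠ lterm cls i 1 u' := lterm_ne cls (by simp)
  have hθ14 := θ_ne_of_dom d v hne d₁ d₄
  have cell : ∀ {b b' : Fin 3 × Fin 2 × Fin 6} {c : Fin 5}, row36 b.1 b.2.1 b.2.2 c = row36 b'.1 b'.2.1 b'.2.2 c →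
      (lterm cls b.1 b.2.1 b.2.2).1 c = (lterm cls b'.1 b'.2.1 b'.2.2).1 c ∧
        (lterm cls b.1 b.2.1 b.2.2).2 c = (lterm cls b'.1 b'.2.1 b'.2.2).2 c := by
    intro b b' c h
    refine ⟨?_, ?_⟩
    · show perm36 _ _ _ c = perm36 _ _ _ c
      rw [← row36_eq, ← row36_eq, h]
    · show cls (row36 _ _ _ c) c = cls (row36 _ _ _ c) c
      rw [h]
  -- the split square with `S = {0,1}`: p₁₁ = (0,u), p₁₂ = (0,u'), p₂₁ = (1,u), p₂₂ = (1,u')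
  have hS : ∀ c : Fin 5, c ∈ ({0, 1} : Finset (Fin 5)) ↔ c.val < 2 := by
    intro c
    simp only [Finset.mem_insert, Finset.mem_singleton]
    constructor
    · rintro (rfl | rfl) <;> decide
    · intro h; have := c.isLt; rcases c with ⟨c, _⟩; simp only [Fin.ext_iff]; simp only at h ⊢; omega
  have HL : ∀ c ∈ ({0, 1} : Finset (Fin 5)), _ := fun c hc =>
    cell (b := (i, (0 : Fin 2), u)) (b' := (i, (0 : Fin 2), u')) ((row36_split i 0 0 u u' c).1 ((hS c).1 hc))
  have HL' : ∀ c ∈ ({0, 1} : Finset (Fin 5)), _ := fun c hc =>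
    cell (b := (i, (1 : Fin 2), u)) (b' := (i, (1 : Fin 2), u')) ((row36_split i 1 1 u u' c).1 ((hS c).1 hc))
  have HR : ∀ c, c ∉ ({0, 1} : Finset (Fin 5)) → _ := fun c hc =>
    cell (b := (i, (0 : Fin 2), u)) (b' := (i, (1 : Fin 2), u)) ((row36_split i 0 1 u u c).2 (by have := (hS c).not.1 hc; omega))
  have HR' : ∀ c, c ∉ ({0, 1} : Finset (Fin 5)) → _ := fun c hc =>
    cell (b := (i, (0 : Fin 2), u')) (b' := (i, (1 : Fin 2), u')) ((row36_split i 0 1 u' u' c).2 (by have := (hS c).not.1 hc; omega))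
  have n12 : lterm cls i 0 u ≠ lterm cls i 0 u' := lterm_ne cls (by simp [huu])
  have n13 : lterm cls i 0 u ≠ lterm cls i 1 u := lterm_ne cls (by simp)
  have n42 : lterm cls i 1 u' ≠ lterm cls i 0 u' := lterm_ne cls (by simp)
  have n43 : lterm cls i 1 u' ≠ lterm cls i 1 u := lterm_ne cls (by simp [Ne.symm huu])
  rcases lt_or_gt_of_ne hθ14 with h14 | h41
  · have B := Bracketing.slope_bracket_split d v ε ({0, 1} : Finset (Fin 5)) h14 HL HL' HR HR' n12 n13 d₁ d₄
    simp only [slope_lterm] at B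
    obtain ⟨b1, b2, b3, _⟩ := B
    exact mul_pos (by linarith) (by linarith)
  · -- the diagonal read backwards: p₁₁ := (1,u'), p₂₂ := (0,u); corners (1,u), (0,u')
    have B := Bracketing.slope_bracket_split d v ε ({0, 1} : Finset (Fin 5)) h41
      (p₁₁ := lterm cls i 1 u') (p₁₂ := lterm cls i 1 u) (p₂₁ := lterm cls i 0 u') (p₂₂ := lterm cls i 0 u)
      (fun c hc => by have := HL' c hc; exact ⟨this.1.symm, this.2.symm⟩) (fun c hc => by have := HL c hc; exact ⟨this.1.symm, this.2.symm⟩)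
      (fun c hc => by have := HR' c hc; exact ⟨this.1.symm, this.2.symm⟩) (fun c hc => by have := HR c hc; exact ⟨this.1.symm, this.2.symm⟩)
      n43 n42 d₄ d₁
    simp only [slope_lterm] at B
    obtain ⟨b1, b2, b3, _⟩ := B
    exact mul_pos_of_neg_of_neg (by linarith) (by linarith)

end Chain


/-! ### 5. The parity-class law inside a coset -/

section Parity

variable {K : ℕ} (d : Fin K → ℕ) (v : Fin 5 → Fin 5 → Fin K → ℤ) {ε : Fin 5 → Fin 5 → Fin K → ℤ} {cls : Fin 5 → Fin 5 → Fin K}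
variable {n : ℕ} {θ : Fin (n + 1) → ℤ} {p : Fin (n + 1) → Equiv.Perm (Fin 5) × (Fin 5 → Fin K)}

/-- the weight identity of the six terms of a coset with a fixed left: evens = odds (slopes and values are both Latin). -/
theorem weight_latin (i : Fin 3) (l : Fin 2) (θ₀ : ℤ) :
    tropWeight d v θ₀ (lterm cls i l 0) + tropWeight d v θ₀ (lterm cls i l 1) + tropWeight d v θ₀ (lterm cls i l 2) =
      tropWeight d v θ₀ (lterm cls i l 3) + tropWeight d v θ₀ (lterm cls i l 4) + tropWeight d v θ₀ (lterm cls i l 5) := by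
  simp only [weight_lterm]
  have ha := cellR_latin (aOf d cls) i
  have hv := cellR_latin (vOf v cls) i
  linear_combination θ₀ * ha - hv

/-- **parity-class law, even class dominant**: if the three even rights occur with the same left `l`, no odd right lies weakly below all of
them in (right) slope while an odd right lies weakly above all of them. -/
theorem law_even (hs : IsStatic ε) (hcls : ∀ r c k, ε r c k ≠ 0 → ε r c (cls r c) ≠ 0) (hdom : ∀ k, IsDominant d v ε (θ k) (p k))
    {i : Fin 3} {l : Fin 2} (w0 : (∃ k, (p k).1 = perm36 i l 0)) (w1 : (∃ k, (p k).1 = perm36 i l 1)) (w2 : (∃ k, (p k).1 = perm36 i l 2)) {o o' : Fin 6}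
    (ho : o = 3 ∨ o = 4 ∨ o = 5) (ho' : o' = 3 ∨ o' = 4 ∨ o' = 5)
    (hlo : cellR (aOf d cls) i o ≤ cellR (aOf d cls) i 0 ∧ cellR (aOf d cls) i o ≤ cellR (aOf d cls) i 1 ∧
      cellR (aOf d cls) i o ≤ cellR (aOf d cls) i 2)
    (hhi : cellR (aOf d cls) i 0 ≤ cellR (aOf d cls) i o' ∧ cellR (aOf d cls) i 1 ≤ cellR (aOf d cls) i o' ∧
      cellR (aOf d cls) i 2 ≤ cellR (aOf d cls) i o') : False := by
  obtain ⟨k₀, d₀⟩ := dom_of_W d v hs hcls hdom w0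
  obtain ⟨k₁, d₁⟩ := dom_of_W d v hs hcls hdom w1
  obtain ⟨k₂, d₂⟩ := dom_of_W d v hs hcls hdom w2
  -- presence of the odd terms: their cells are cells of even terms
  have pres : ∀ o₀ : Fin 6, (o₀ = 3 ∨ o₀ = 4 ∨ o₀ = 5) → termSign ε (lterm cls i l o₀) ≠ 0 := by
    intro o₀ h
    refine lterm_present hcls fun c => ?_
    rcases row36_odd_cover i l o₀ c h with e | e | e <;> rw [e]
    · exact cells_present d₀.1 rfl c
    · exact cells_present d₁.1 rfl c
    · exact cells_present d₂.1 rfl c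
  have sl : ∀ u : Fin 6, TropicalCensus.slope d (lterm cls i l u) = cellL (aOf d cls) i l + cellR (aOf d cls) i u := slope_lterm d cls i l
  refine parity_class_any_order d v ε (o := lterm cls i l o) (o' := lterm cls i l o')
    (θ_ne_of_dom d v (lterm_ne cls (by simp)) d₀ d₁) (θ_ne_of_dom d v (lterm_ne cls (by simp)) d₀ d₂)
    (θ_ne_of_dom d v (lterm_ne cls (by simp)) d₁ d₂) (lterm_ne cls (by simp)) (weight_latin d v i l) ?_ ?_
    (pres 3 (by simp)) (pres 4 (by simp)) (pres 5 (by simp))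
    ⟨lterm_ne cls (by simp), lterm_ne cls (by simp), lterm_ne cls (by simp)⟩
    ⟨lterm_ne cls (by simp), lterm_ne cls (by simp), lterm_ne cls (by simp)⟩
    ⟨lterm_ne cls (by simp), lterm_ne cls (by simp), lterm_ne cls (by simp)⟩ d₀ d₁ d₂ ?_ ?_
  · rcases ho with rfl | rfl | rfl <;> simp
  · rcases ho' with rfl | rfl | rfl <;> simp
  · simp only [sl]; exact ⟨by linarith [hlo.1], by linarith [hlo.2.1], by linarith [hlo.2.2]⟩
  · simp only [sl]; exact ⟨by linarith [hhi.1], by linarith [hhi.2.1], by linarith [hhi.2.2]⟩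

/-- **parity-class law, odd class dominant** (symmetric statement). -/
theorem law_odd (hs : IsStatic ε) (hcls : ∀ r c k, ε r c k ≠ 0 → ε r c (cls r c) ≠ 0) (hdom : ∀ k, IsDominant d v ε (θ k) (p k))
    {i : Fin 3} {l : Fin 2} (w3 : (∃ k, (p k).1 = perm36 i l 3)) (w4 : (∃ k, (p k).1 = perm36 i l 4)) (w5 : (∃ k, (p k).1 = perm36 i l 5)) {e e' : Fin 6}
    (he : e = 0 ∨ e = 1 ∨ e = 2) (he' : e' = 0 ∨ e' = 1 ∨ e' = 2)
    (hlo : cellR (aOf d cls) i e ≤ cellR (aOf d cls) i 3 ∧ cellR (aOf d cls) i e ≤ cellR (aOf d cls) i 4 ∧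
      cellR (aOf d cls) i e ≤ cellR (aOf d cls) i 5)
    (hhi : cellR (aOf d cls) i 3 ≤ cellR (aOf d cls) i e' ∧ cellR (aOf d cls) i 4 ≤ cellR (aOf d cls) i e' ∧
      cellR (aOf d cls) i 5 ≤ cellR (aOf d cls) i e') : False := by
  obtain ⟨k₃, d₃⟩ := dom_of_W d v hs hcls hdom w3
  obtain ⟨k₄, d₄⟩ := dom_of_W d v hs hcls hdom w4
  obtain ⟨k₅, d₅⟩ := dom_of_W d v hs hcls hdom w5
  have pres : ∀ e₀ : Fin 6, (e₀ = 0 ∨ e₀ = 1 ∨ e₀ = 2) → termSign ε (lterm cls i l e₀) ≠ 0 := by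
    intro e₀ h
    refine lterm_present hcls fun c => ?_
    rcases row36_even_cover i l e₀ c h with q | q | q <;> rw [q]
    · exact cells_present d₃.1 rfl c
    · exact cells_present d₄.1 rfl c
    · exact cells_present d₅.1 rfl c
  have sl : ∀ u : Fin 6, TropicalCensus.slope d (lterm cls i l u) = cellL (aOf d cls) i l + cellR (aOf d cls) i u := slope_lterm d cls i l
  refine parity_class_any_order d v ε (e₁ := lterm cls i l 3) (e₂ := lterm cls i l 4) (e₃ := lterm cls i l 5)
    (o₁ := lterm cls i l 0) (o₂ := lterm cls i l 1) (o₃ := lterm cls i l 2) (o := lterm cls i l e) (o' := lterm cls i l e')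
    (θ_ne_of_dom d v (lterm_ne cls (by simp)) d₃ d₄) (θ_ne_of_dom d v (lterm_ne cls (by simp)) d₃ d₅)
    (θ_ne_of_dom d v (lterm_ne cls (by simp)) d₄ d₅) (lterm_ne cls (by simp)) (fun θ₀ => (weight_latin d v i l θ₀).symm) ?_ ?_
    (pres 0 (by simp)) (pres 1 (by simp)) (pres 2 (by simp))
    ⟨lterm_ne cls (by simp), lterm_ne cls (by simp), lterm_ne cls (by simp)⟩
    ⟨lterm_ne cls (by simp), lterm_ne cls (by simp), lterm_ne cls (by simp)⟩
    ⟨lterm_ne cls (by simp), lterm_ne cls (by simp), lterm_ne cls (by simp)⟩ d₃ d₄ d₅ ?_ ?_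
  · rcases he with rfl | rfl | rfl <;> simp
  · rcases he' with rfl | rfl | rfl <;> simp
  · simp only [sl]; exact ⟨by linarith [hlo.1], by linarith [hlo.2.1], by linarith [hlo.2.2]⟩
  · simp only [sl]; exact ⟨by linarith [hhi.1], by linarith [hhi.2.1], by linarith [hhi.2.2]⟩

end Parity

/-! ### 6. Counting inside a coset: at most 7, and the structure of a full coset -/

section Count

/-- the fibre of a set of `(left, right)` pairs over a right. -/
theorem fiber_card_le (T : Finset (Fin 2 × Fin 6)) (u : Fin 6) :
    #(T.filter fun x => x.2 = u) ≤ 2 ∧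
    (¬((0, u) ∈ T ∧ (1, u) ∈ T) → #(T.filter fun x => x.2 = u) ≤ 1) := by
  have hsub : (T.filter fun x => x.2 = u) ⊆ ({(0, u), (1, u)} : Finset (Fin 2 × Fin 6)) := by
    intro x hx
    simp only [Finset.mem_filter] at hx
    rcases x with ⟨l, u'⟩
    simp only at hx
    obtain ⟨-, rfl⟩ := hx
    simp only [Finset.mem_insert, Finset.mem_singleton, Prod.mk.injEq, and_true]
    rcases Fin.exists_fin_two.mp ⟨l, rfl⟩ with h | h <;> simp [h]
  refine ⟨(Finset.card_le_card hsub).trans (Finset.card_insert_le _ _), fun hnot => ?_⟩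
  by_cases h0 : (0, u) ∈ T
  · have h1 : (1, u) ∉ T := fun h1 => hnot ⟨h0, h1⟩
    have : (T.filter fun x => x.2 = u) ⊆ {(0, u)} := by
      intro x hx
      have hx' := hsub hx
      simp only [Finset.mem_insert, Finset.mem_singleton] at hx' ⊢
      rcases hx' with rfl | rfl
      · rfl
      · exact absurd (Finset.mem_filter.mp hx).1 h1
    exact (Finset.card_le_card this).trans (by simp)
  · have : (T.filter fun x => x.2 = u) ⊆ {(1, u)} := by
      intro x hx
      have hx' := hsub hx
      simp only [Finset.mem_insert, Finset.mem_singleton] at hx' ⊢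
      rcases hx' with rfl | rfl
      · exact absurd (Finset.mem_filter.mp hx).1 h0
      · rfl
    exact (Finset.card_le_card this).trans (by simp)

/-- **at most 7 per coset, and the structure of 7**: if no two rights occur with both lefts, a set of `(left, right)` pairs has at most `7`
elements, and if it has `7` then exactly one right (the pivot) occurs with both lefts and every other right with exactly one. -/
theorem coset_count (T : Finset (Fin 2 × Fin 6))
    (hsq : ∀ u u' : Fin 6, u ≠ u' → ¬((0, u) ∈ T ∧ (0, u') ∈ T ∧ (1, u) ∈ T ∧ (1, u') ∈ T)) :
    #T ≤ 7 ∧ (#T = 7 → ∃ k : Fin 6, (0, k) ∈ T ∧ (1, k) ∈ T ∧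
      ∀ u : Fin 6, u ≠ k → (((0, u) ∈ T ∧ (1, u) ∉ T) ∨ ((0, u) ∉ T ∧ (1, u) ∈ T))) := by
  classical
  have hcard : #T = ∑ u : Fin 6, #(T.filter fun x => x.2 = u) :=
    Finset.card_eq_sum_card_fiberwise (f := fun x : Fin 2 × Fin 6 => x.2) (fun _ _ => Finset.mem_univ _)
  -- bound each fibre by `1 + [both lefts at u]`
  let b : Fin 6 → ℕ := fun u => if (0, u) ∈ T ∧ (1, u) ∈ T then 2 else 1
  have hle : ∀ u ∈ (univ : Finset (Fin 6)), #(T.filter fun x => x.2 = u) ≤ b u := by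
    intro u _
    by_cases h : (0, u) ∈ T ∧ (1, u) ∈ T
    · simp only [b, h, and_self, if_true]; exact (fiber_card_le T u).1
    · simp only [b, h, if_false]; exact (fiber_card_le T u).2 h
  -- at most one `u` with both lefts
  have huniq : ∀ u u' : Fin 6, (0, u) ∈ T ∧ (1, u) ∈ T → (0, u') ∈ T ∧ (1, u') ∈ T → u = u' := by
    intro u u' hu hu'
    by_contra hne
    exact hsq u u' hne ⟨hu.1, hu'.1, hu.2, hu'.2⟩
  have hbsum : ∑ u : Fin 6, b u ≤ 7 := by
    by_cases hex : ∃ k, (0, k) ∈ T ∧ (1, k) ∈ T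
    · obtain ⟨k, hk⟩ := hex
      have hb : ∀ u, b u = if u = k then 2 else 1 := by
        intro u
        by_cases hu : u = k
        · simp [b, hu, hk]
        · have : ¬((0, u) ∈ T ∧ (1, u) ∈ T) := fun h => hu (huniq u k h hk)
          simp [b, this, hu]
      simp only [hb]
      rw [Finset.sum_ite, Finset.sum_const, Finset.sum_const]
      simp only [smul_eq_mul]
      have h1 : #(univ.filter fun u : Fin 6 => u = k) = 1 := by
        rw [Finset.filter_eq' univ k]; simp
      have h2 : #(univ.filter fun u : Fin 6 => ¬u = k) = 5 := by
        have := Finset.card_filter_add_card_filter_not (s := (univ : Finset (Fin 6))) (fun u : Fin 6 => u = k)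
        rw [h1] at this; simp only [Finset.card_univ, Fintype.card_fin] at this; omega
      rw [h1, h2]
    · have hb : ∀ u, b u = 1 := by
        intro u
        have : ¬((0, u) ∈ T ∧ (1, u) ∈ T) := fun h => hex ⟨u, h⟩
        simp [b, this]
      simp [hb]
  have hsum_le : ∑ u : Fin 6, #(T.filter fun x => x.2 = u) ≤ ∑ u : Fin 6, b u := Finset.sum_le_sum hle
  refine ⟨by omega, fun h7 => ?_⟩
  -- with 7 elements every fibre attains its bound and some `u` has both lefts
  have heq : ∑ u : Fin 6, #(T.filter fun x => x.2 = u) = ∑ u : Fin 6, b u := by omega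
  have hfib : ∀ u ∈ (univ : Finset (Fin 6)), #(T.filter fun x => x.2 = u) = b u := (Finset.sum_eq_sum_iff_of_le hle).1 heq
  have hex : ∃ k, (0, k) ∈ T ∧ (1, k) ∈ T := by
    by_contra hno
    push Not at hno
    have hb : ∀ u, b u = 1 := by
      intro u
      have : ¬((0, u) ∈ T ∧ (1, u) ∈ T) := fun h => hno u h.1 h.2
      simp [b, this]
    have : ∑ u : Fin 6, b u = 6 := by simp [hb]
    omega
  obtain ⟨k, hk⟩ := hex
  refine ⟨k, hk.1, hk.2, fun u hu => ?_⟩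
  have hnot : ¬((0, u) ∈ T ∧ (1, u) ∈ T) := fun h => hu (huniq u k h hk)
  have hone : #(T.filter fun x => x.2 = u) = 1 := by
    have := hfib u (Finset.mem_univ _)
    simp only [b, hnot, if_false] at this
    exact this
  obtain ⟨x, hx⟩ := Finset.card_eq_one.1 hone
  have hxmem : x ∈ T.filter fun y => y.2 = u := by rw [hx]; exact Finset.mem_singleton_self _
  have hx2 : x.2 = u := (Finset.mem_filter.1 hxmem).2
  have hxT : x ∈ T := (Finset.mem_filter.1 hxmem).1
  rcases x with ⟨l, u'⟩
  simp only at hx2; subst hx2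
  rcases Fin.exists_fin_two.mp ⟨l, rfl⟩ with hl | hl
  · subst hl
    left
    exact ⟨hxT, fun h1 => hnot ⟨hxT, h1⟩⟩
  · subst hl
    right
    exact ⟨fun h0 => hnot ⟨h0, hxT⟩, hxT⟩

end Count



end Summit.ValiantsHypothesis.ValiantsHypothesis.Theorems.KPlusLogSqLaw.StaticFiveTriangle
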